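import Summits.SmoothPoincare4.SmoothPoincare4.Theorems.SymplecticOrigamiGromovRecognitionRelEndStubCapModelGlueACS2
import Literature.Geometry.Kaehler.ManifoldFormsPullback

/-!
# Wedge cap for `GromovRecognitionRelEnd` — gluing differential forms along a pushout
(stub `stub_capModel` of line `cross-cap-laurent`, crux `SymplecticOrigami.GromovRecognitionRelEnd`,
item stmt-SmoothPoincare4-11009; generic auxiliary file)

For a gluing datum `d : SmoothGlueData 𝓘(ℝ, E) 𝓘(ℝ, E) A B E` and forms `β_A`, `β_B` on the pieces
with `glue^* β_B = β_A` on the source of the gluing map, the push-forwards `(inl⁻¹)^* β_A`,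
`(inr⁻¹)^* β_B` agree on the overlap and define a form `d.glueForm β_A β_B` on `d.Glued` with
`inl^* (glueForm) = β_A`, `inr^* (glueForm) = β_B`; it is smooth (closed) when both pieces are
(locality of smoothness and of `d`, Warner 2.22–2.23 via the tree's `MForm.SmoothAt.pullback`,
`mextDeriv_pullback_apply`), and an almost complex structure glued from `β`-tame pieces
(`GlueJ.glueACS`) is tamed by it (`glueForm_tames`). Kosinski VI.1; McDuff–Salamon 2017, (4.1.1).
-/

noncomputable section

-- the registered namespace `Summit.SmoothPoincare4.SmoothPoincare4.Theorems…` repeats a component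
set_option linter.dupNamespace false

open scoped Manifold ContDiff Topology
open Bundle Set Function Filter Literature.Geometry.Symplectic Literature.Topology.FourManifolds
  Literature.Geometry.Kaehler

namespace Summit.SmoothPoincare4.SmoothPoincare4.Theorems.GromovRecognitionRelEnd.CrossCapLaurent

namespace CapModel

/-! ## Push-forward of a form along an open smooth embedding -/

section Emb

variable {E : Type*} [NormedAddCommGroup E] [NormedSpace ℝ E] {H : Type*} [TopologicalSpace H]
  {I : ModelWithCorners ℝ E H} {P : Type*} [TopologicalSpace P] [ChartedSpace H P]
  {E' : Type*} [NormedAddCommGroup E'] [NormedSpace ℝ E'] {H' : Type*} [TopologicalSpace H']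
  {I' : ModelWithCorners ℝ E' H'} {X : Type*} [TopologicalSpace X] [ChartedSpace H' X]
  {F : Type*} [NormedAddCommGroup F] [NormedSpace ℝ F] {k : ℕ}
  [Nonempty P] {e : P → X}

omit [Nonempty P] in
/-- Evaluating a form at propositionally equal points on the same (model-space valued) vectors.
[folklore] -/
theorem MForm.congr_point {M : Type*} [TopologicalSpace M] [ChartedSpace H M] (β : MForm I M F k)
    {x y : M} (h : x = y) (u : Fin k → E) : β x u = β y u := by
  subst h; rfl

omit [Nonempty P] in
/-- Two forms agree at `e p` as soon as their pull-backs along `e` agree at `p`, if `de_p` is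
surjective. [folklore] -/
theorem MForm.eq_of_pullback_eq {γ₁ γ₂ : MForm I' X F k} {p : P}
    (hsurj : Surjective (mfderiv I I' e p)) (h : γ₁.pullback I e p = γ₂.pullback I e p) :
    γ₁ (e p) = γ₂ (e p) := by
  ext w
  choose u hu using fun i => hsurj (w i)
  have hw : w = fun i => mfderiv I I' e p (u i) := funext fun i => (hu i).symm
  have h' := congrArg (fun γ : TangentSpace I p [⋀^Fin k]→L[ℝ] F => γ u) h
  simp only [MForm.pullback_apply] at h'
  rw [hw]
  exact h'

/-- **`e^* ((e⁻¹)^* β) = β`** for an open smooth embedding `e`. [folklore] -/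
theorem pullback_pullback_invFun (hem : Manifold.IsSmoothEmbedding I I' ∞ e)
    (hop : IsOpen (range e)) (β : MForm I P F k) (p : P) :
    (β.pullback I' (invFun e)).pullback I e p = β p := by
  ext u
  simp only [MForm.pullback_apply, mfderiv_invFun_apply_mfderiv hem hop]
  exact MForm.congr_point β (invFun_apply hem.isEmbedding.injective p) u

variable [IsManifold I ∞ P] [IsManifold I' ∞ X]

/-- The push-forward `(e⁻¹)^* β` is smooth at a point of the range over which `β` is smooth.
[cite: WarnerGTM94, 2.22] -/
theorem smoothAt_pullback_invFun (hem : Manifold.IsSmoothEmbedding I I' ∞ e)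
    (hop : IsOpen (range e)) {β : MForm I P F k} {y : X} (hy : y ∈ range e)
    (hβ : β.SmoothAt (invFun e y)) : (β.pullback I' (invFun e)).SmoothAt y :=
  MForm.SmoothAt.pullback (eventually_contMDiffAt_invFun hem hop hy) hβ

/-- `d((e⁻¹)^* β) = (e⁻¹)^* dβ` at a point of the range over which `β` is smooth.
[cite: WarnerGTM94, Prop. 2.23] -/
theorem mextDeriv_pullback_invFun (hem : Manifold.IsSmoothEmbedding I I' ∞ e)
    (hop : IsOpen (range e)) {β : MForm I P F k} {y : X} (hy : y ∈ range e)
    (hβ : β.SmoothAt (invFun e y)) :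
    mextDeriv (β.pullback I' (invFun e)) y = (mextDeriv β).pullback I' (invFun e) y :=
  mextDeriv_pullback_apply (eventually_contMDiffAt_invFun hem hop hy) hβ

end Emb

/-! ## Gluing forms along a pushout -/

namespace GlueF

universe uA uB

variable {E : Type*} [NormedAddCommGroup E] [NormedSpace ℝ E]
  {A : Type uA} [TopologicalSpace A] [ChartedSpace E A] [IsManifold 𝓘(ℝ, E) ∞ A]
  {B : Type uB} [TopologicalSpace B] [ChartedSpace E B] [IsManifold 𝓘(ℝ, E) ∞ B]
  (d : SmoothGlueData 𝓘(ℝ, E) 𝓘(ℝ, E) A B E) [Nonempty A] [Nonempty B]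
  {F : Type*} [NormedAddCommGroup F] [NormedSpace ℝ F] {k : ℕ}

variable {d} in
/-- **Compatibility on the overlap**: if `glue^* β_B = β_A` on the source then
`(inl⁻¹)^* β_A = (inr⁻¹)^* β_B` on `range inl ∩ range inr`. [folklore] -/
theorem pullback_invFun_inl_eq {βA : MForm 𝓘(ℝ, E) A F k} {βB : MForm 𝓘(ℝ, E) B F k}
    (hc : ∀ a ∈ d.glue.source, βB.pullback 𝓘(ℝ, E) d.glue a = βA a)
    {y : d.Glued} (hyl : y ∈ range d.inl) (hyr : y ∈ range d.inr) :
    βA.pullback 𝓘(ℝ, E) (invFun d.inl) y = βB.pullback 𝓘(ℝ, E) (invFun d.inr) y := by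
  obtain ⟨b, rfl⟩ := hyr
  have hb : b ∈ d.glue.target := d.inr_mem_range_inl_iff.1 hyl
  have ha : d.glue.symm b ∈ d.glue.source := d.glue.map_target hb
  have hab : d.glue (d.glue.symm b) = b := d.glue.right_inv hb
  refine MForm.eq_of_pullback_eq
    (mfderiv_surjective d.isSmoothEmbedding_inr d.isOpen_range_inr b) ?_
  rw [pullback_pullback_invFun d.isSmoothEmbedding_inr d.isOpen_range_inr]
  ext u
  simp only [MForm.pullback_apply, GlueJ.mfderiv_invFun_inl_inr d hb]
  calc βA (invFun d.inl (d.inr b)) (fun i => mfderiv 𝓘(ℝ, E) 𝓘(ℝ, E) d.glue.symm b (u i))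
      = βA (d.glue.symm b) (fun i => mfderiv 𝓘(ℝ, E) 𝓘(ℝ, E) d.glue.symm b (u i)) :=
        MForm.congr_point βA (GlueJ.invFun_inl_inr d hb) _
    _ = (βB.pullback 𝓘(ℝ, E) d.glue) (d.glue.symm b)
          (fun i => mfderiv 𝓘(ℝ, E) 𝓘(ℝ, E) d.glue.symm b (u i)) := by rw [hc _ ha]
    _ = βB (d.glue (d.glue.symm b)) (fun i => u i) := by
        simp only [MForm.pullback_apply, GlueJ.mfderiv_glue_apply_mfderiv_glue_symm d hb]
    _ = βB b u := MForm.congr_point βB hab u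

/-- The glued form: `(inl⁻¹)^* β_A` on `range inl`, `(inr⁻¹)^* β_B` elsewhere. [folklore] -/
def glueForm (βA : MForm 𝓘(ℝ, E) A F k) (βB : MForm 𝓘(ℝ, E) B F k) :
    MForm 𝓘(ℝ, E) d.Glued F k := fun y =>
  open scoped Classical in
  if y ∈ range d.inl then βA.pullback 𝓘(ℝ, E) (invFun d.inl) y
  else βB.pullback 𝓘(ℝ, E) (invFun d.inr) y

variable {βA : MForm 𝓘(ℝ, E) A F k} {βB : MForm 𝓘(ℝ, E) B F k}

variable {d} in
/-- On `range inl` the glued form is `(inl⁻¹)^* β_A`. [folklore] -/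
theorem glueForm_of_mem_inl {y : d.Glued} (hy : y ∈ range d.inl) :
    glueForm d βA βB y = βA.pullback 𝓘(ℝ, E) (invFun d.inl) y := by
  simp only [glueForm, hy, if_true]

variable {d} in
/-- On `range inr` the glued form is `(inr⁻¹)^* β_B`. [folklore] -/
theorem glueForm_of_mem_inr (hc : ∀ a ∈ d.glue.source, βB.pullback 𝓘(ℝ, E) d.glue a = βA a)
    {y : d.Glued} (hy : y ∈ range d.inr) :
    glueForm d βA βB y = βB.pullback 𝓘(ℝ, E) (invFun d.inr) y := by
  by_cases hyl : y ∈ range d.inl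
  · rw [glueForm_of_mem_inl hyl, pullback_invFun_inl_eq hc hyl hy]
  · simp only [glueForm, hyl, if_false]

/-- Near a point of `range inl` the glued form is `(inl⁻¹)^* β_A`. [folklore] -/
theorem glueForm_eventuallyEq_inl (a : A) :
    ∀ᶠ y in 𝓝 (d.inl a), glueForm d βA βB y = βA.pullback 𝓘(ℝ, E) (invFun d.inl) y := by
  filter_upwards [d.isOpen_range_inl.mem_nhds (mem_range_self a)] with y hy
  exact glueForm_of_mem_inl hy

/-- Near a point of `range inr` the glued form is `(inr⁻¹)^* β_B`. [folklore] -/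
theorem glueForm_eventuallyEq_inr (hc : ∀ a ∈ d.glue.source, βB.pullback 𝓘(ℝ, E) d.glue a = βA a)
    (b : B) :
    ∀ᶠ y in 𝓝 (d.inr b), glueForm d βA βB y = βB.pullback 𝓘(ℝ, E) (invFun d.inr) y := by
  filter_upwards [d.isOpen_range_inr.mem_nhds (mem_range_self b)] with y hy
  exact glueForm_of_mem_inr hc hy

/-- **`inl^* (glueForm) = β_A`.** [folklore] -/
theorem glueForm_pullback_inl (a : A) : (glueForm d βA βB).pullback 𝓘(ℝ, E) d.inl a = βA a := by
  have h : (glueForm d βA βB).pullback 𝓘(ℝ, E) d.inl a =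
      (βA.pullback 𝓘(ℝ, E) (invFun d.inl)).pullback 𝓘(ℝ, E) d.inl a := by
    ext u
    simp only [MForm.pullback_apply, glueForm_of_mem_inl (mem_range_self a)]
  rw [h, pullback_pullback_invFun d.isSmoothEmbedding_inl d.isOpen_range_inl]

/-- **`inr^* (glueForm) = β_B`.** [folklore] -/
theorem glueForm_pullback_inr (hc : ∀ a ∈ d.glue.source, βB.pullback 𝓘(ℝ, E) d.glue a = βA a)
    (b : B) : (glueForm d βA βB).pullback 𝓘(ℝ, E) d.inr b = βB b := by
  have h : (glueForm d βA βB).pullback 𝓘(ℝ, E) d.inr b =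
      (βB.pullback 𝓘(ℝ, E) (invFun d.inr)).pullback 𝓘(ℝ, E) d.inr b := by
    ext u
    simp only [MForm.pullback_apply, glueForm_of_mem_inr hc (mem_range_self b)]
  rw [h, pullback_pullback_invFun d.isSmoothEmbedding_inr d.isOpen_range_inr]

/-- **The glued form is smooth** if both pieces are. [cite: WarnerGTM94, 2.22] -/
theorem isSmoothForm_glueForm (hc : ∀ a ∈ d.glue.source, βB.pullback 𝓘(ℝ, E) d.glue a = βA a)
    (hA : IsSmoothForm βA) (hB : IsSmoothForm βB) : IsSmoothForm (glueForm d βA βB) := by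
  intro y
  rcases d.exists_inl_or_inr y with ⟨a, rfl⟩ | ⟨b, rfl⟩
  · exact (smoothAt_pullback_invFun d.isSmoothEmbedding_inl d.isOpen_range_inl (mem_range_self a)
      (hA _)).congr_of_eventuallyEq ((glueForm_eventuallyEq_inl d a).mono fun _ h => h.symm)
  · exact (smoothAt_pullback_invFun d.isSmoothEmbedding_inr d.isOpen_range_inr (mem_range_self b)
      (hB _)).congr_of_eventuallyEq ((glueForm_eventuallyEq_inr d hc b).mono fun _ h => h.symm)

/-- **The glued form is closed** if both pieces are smooth and closed. [cite: WarnerGTM94, Prop. 2.23] -/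
theorem isClosedForm_glueForm (hc : ∀ a ∈ d.glue.source, βB.pullback 𝓘(ℝ, E) d.glue a = βA a)
    (hA : IsSmoothForm βA) (hB : IsSmoothForm βB) (hA' : IsClosedForm βA) (hB' : IsClosedForm βB) :
    IsClosedForm (glueForm d βA βB) := by
  funext y
  rcases d.exists_inl_or_inr y with ⟨a, rfl⟩ | ⟨b, rfl⟩
  · rw [mextDeriv_congr_of_eventuallyEq (glueForm_eventuallyEq_inl d a),
      mextDeriv_pullback_invFun d.isSmoothEmbedding_inl d.isOpen_range_inl (mem_range_self a) (hA _),
      show mextDeriv βA = 0 from hA', MForm.pullback_zero]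
  · rw [mextDeriv_congr_of_eventuallyEq (glueForm_eventuallyEq_inr d hc b),
      mextDeriv_pullback_invFun d.isSmoothEmbedding_inr d.isOpen_range_inr (mem_range_self b) (hB _),
      show mextDeriv βB = 0 from hB', MForm.pullback_zero]

/-- Evaluating a form at `f x` on push-forwards of a pair is evaluating the pull-back on the pair.
[folklore] -/
theorem apply_pair_mfderiv {M N : Type*} [TopologicalSpace M] [ChartedSpace E M]
    [TopologicalSpace N] [ChartedSpace E N] (γ : MForm 𝓘(ℝ, E) N ℝ 2) (f : M → N) (x : M)
    (u w : E) :
    γ (f x) ![mfderiv 𝓘(ℝ, E) 𝓘(ℝ, E) f x u, mfderiv 𝓘(ℝ, E) 𝓘(ℝ, E) f x w] =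
      γ.pullback 𝓘(ℝ, E) f x ![u, w] := by
  rw [MForm.pullback_apply]
  congr 1
  funext i; fin_cases i <;> rfl

/-- **Taming glues**: if `J_A` is `β_A`-tame and `J_B` is `β_B`-tame then the glued structure is
tamed by the glued form. [cite: McDuffSalamon2017, §4.1 (4.1.1)] -/
theorem glueForm_tames {βA : MForm 𝓘(ℝ, E) A ℝ 2} {βB : MForm 𝓘(ℝ, E) B ℝ 2}
    (hc : ∀ a ∈ d.glue.source, βB.pullback 𝓘(ℝ, E) d.glue a = βA a)
    {JA : AlmostComplexStructure 𝓘(ℝ, E) ∞ A} {JB : AlmostComplexStructure 𝓘(ℝ, E) ∞ B}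
    (hol : ∀ a ∈ d.glue.source, ∀ v : E, mfderiv 𝓘(ℝ, E) 𝓘(ℝ, E) d.glue a (JA a v) =
      JB (d.glue a) (mfderiv 𝓘(ℝ, E) 𝓘(ℝ, E) d.glue a v))
    (htA : JA.IsTamedBy βA) (htB : JB.IsTamedBy βB) :
    (GlueJ.glueACS d JA JB hol).IsTamedBy (glueForm d βA βB) := by
  intro y v hv
  rcases d.exists_inl_or_inr y with ⟨a, rfl⟩ | ⟨b, rfl⟩
  · obtain ⟨u, rfl⟩ := mfderiv_surjective d.isSmoothEmbedding_inl d.isOpen_range_inl a v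
    have hu : u ≠ 0 := by rintro rfl; exact hv (map_zero _)
    rw [GlueJ.glueACS_inl, apply_pair_mfderiv, glueForm_pullback_inl]
    exact htA a u hu
  · obtain ⟨u, rfl⟩ := mfderiv_surjective d.isSmoothEmbedding_inr d.isOpen_range_inr b v
    have hu : u ≠ 0 := by rintro rfl; exact hv (map_zero _)
    rw [GlueJ.glueACS_inr, apply_pair_mfderiv, glueForm_pullback_inr d hc]
    exact htB b u hu

end GlueF

end CapModel

/-- **Registered helper sub-goal `helper_capModelGlueForm`** (generic auxiliary file of stub
`stub_capModel`): smooth closed `2`-forms on the two pieces of an open gluing of `4`-manifolds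
which correspond under the gluing map glue to a smooth closed `2`-form on the pushout restricting
to the given ones. [cite: WarnerGTM94, Prop. 2.23] -/
theorem helper_capModelGlueForm : ∀ (A B : Type) [TopologicalSpace A]
    [ChartedSpace (EuclideanSpace ℝ (Fin 4)) A] [IsManifold (𝓡 4) ∞ A] [TopologicalSpace B]
    [ChartedSpace (EuclideanSpace ℝ (Fin 4)) B] [IsManifold (𝓡 4) ∞ B] [Nonempty A] [Nonempty B]
    (d : Literature.Topology.FourManifolds.SmoothGlueData (𝓡 4) (𝓡 4) A B
      (EuclideanSpace ℝ (Fin 4)))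
    (βA : Literature.Geometry.Kaehler.MForm (𝓡 4) A ℝ 2)
    (βB : Literature.Geometry.Kaehler.MForm (𝓡 4) B ℝ 2),
    Literature.Geometry.Kaehler.IsSmoothForm βA → Literature.Geometry.Kaehler.IsSmoothForm βB →
    Literature.Geometry.Kaehler.IsClosedForm βA → Literature.Geometry.Kaehler.IsClosedForm βB →
    (∀ a ∈ d.glue.source, βB.pullback (𝓡 4) d.glue a = βA a) →
    ∃ β : Literature.Geometry.Kaehler.MForm (𝓡 4) d.Glued ℝ 2,
      Literature.Geometry.Kaehler.IsSmoothForm β ∧ Literature.Geometry.Kaehler.IsClosedForm β ∧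
      (∀ a : A, β.pullback (𝓡 4) d.inl a = βA a) ∧ ∀ b : B, β.pullback (𝓡 4) d.inr b = βB b :=
  fun _ _ _ _ _ _ _ _ _ _ d _ _ hA hB hA' hB' hc => ⟨CapModel.GlueF.glueForm d _ _,
    CapModel.GlueF.isSmoothForm_glueForm d hc hA hB,
    CapModel.GlueF.isClosedForm_glueForm d hc hA hB hA' hB',
    fun a => CapModel.GlueF.glueForm_pullback_inl d a, fun b => CapModel.GlueF.glueForm_pullback_inr d hc b⟩

end Summit.SmoothPoincare4.SmoothPoincare4.Theorems.GromovRecognitionRelEnd.CrossCapLaurent
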